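import Literature.AnabelianGeometry.SemiGraphs.FiniteEtaleCoveringDictionary
import Literature.AnabelianGeometry.Anabelioids.TerminalCoproductComponents
import Literature.AnabelianGeometry.Anabelioids.ExactFunctorProofs

/-!
# The finite étale covering dictionary ([SemiAnbd] §2) — proofs, part 3: (D9)

Mochizuki, *Semi-graphs of anabelioids*, Publ. RIMS **42** (2006), §2 p. 23
[cite: MochizukiSemiAnbd2006, Def. 2.2(i) p.23]: for the finite étale covering `𝒢' → 𝒢` attached
to an object `A = {S_v, T_e, ψ_b}` of `B(𝒢)`, "the vertices … of `𝔾'` that lie over `v` …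
correspond to the connected components of `S_v`".  Hence, when `𝒢` is connected and `A` is a
CONNECTED object, every vertex of `𝒢` carries a vertex of `𝒢'` — the dictionary fact (D9)
`covering_vertexMap_surjective` of `FiniteEtaleCoveringDictionary.lean` (abc-iut-L3-d3), DISCHARGED
here (`covering_vertexMap_surjective_holds`).

The point is that no vertex constituent `S_v` of a non-initial object of `B(𝒢)` over a CONNECTED
semi-graph is initial (`BObj.not_isInitial_S_of_isConnected`): non-initiality is transported along
the gluing isomorphisms `ψ_b : b^* S_v ⥲ T_e` (exact functors preserve and reflect initial objects,
`ExactFunctorProofs`), hence is constant on the (connected) barycentric subdivision of `𝔾`; and an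
object all of whose constituents are initial is initial (`BObj.nonempty_isInitial_of_components`).  A
non-initial object of a connected anabelioid has a connected component (`nonempty_π₀Obj`, from
Mathlib's `fiber_in_connected_component`).  Proof-only; (D8)/(D5) are NOT here.
-/

namespace Literature.AnabelianGeometry.SemiGraphs

open CategoryTheory CategoryTheory.Limits CategoryTheory.PreGaloisCategory
open Literature.AnabelianGeometry.Anabelioids

universe v₁ u₁ u

/-- A predicate respected by adjacency is constant along reachability. [folklore] -/
private theorem iff_of_reachable {V : Type*} {G : SimpleGraph V} (Q : V → Prop)
    (h : ∀ ⦃a b : V⦄, G.Adj a b → (Q a ↔ Q b)) {u v : V} (huv : G.Reachable u v) : Q u ↔ Q v := by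
  obtain ⟨p⟩ := huv
  induction p with
  | nil => exact Iff.rfl
  | cons hadj _ ih => exact (h hadj).trans ih

/-- A non-initial object of a connected anabelioid has a connected component (a connected
subobject). [cite: SGA1, Exp. V §4] -/
theorem nonempty_π₀Obj {C : Type u₁} [Category.{v₁} C] [GaloisCategory C] (X : C)
    (hX : IsInitial X → False) : Nonempty (π₀Obj X) := by
  let F := GaloisCategory.getFiberFunctor C
  obtain ⟨x⟩ := (not_initial_iff_fiber_nonempty F X).mp hX
  obtain ⟨Y, i, -, -, hY, hm⟩ := fiber_in_connected_component F X x
  haveI := hY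
  exact ⟨⟨Subobject.mk i, isConnected_of_iso (Subobject.underlyingIso i).symm⟩⟩

namespace SemiGraphOfAnabelioids

variable {𝒢 : SemiGraphOfAnabelioids.{v₁, u₁, u}}

/-- An object of `B(𝒢)` all of whose constituents are initial is initial.
[cite: MochizukiSemiAnbd2006, Def. 2.1 p.23] -/
theorem BObj.nonempty_isInitial_of_components (A : 𝒢.BObj) (hS : ∀ v, Nonempty (IsInitial (A.S v)))
    (hT : ∀ e, Nonempty (IsInitial (A.T e))) : Nonempty (IsInitial A) :=
  ⟨IsInitial.ofUniqueHom
    (fun _ =>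
      { fS := fun v => (hS v).some.to _
        fT := fun e => (hT e).some.to _
        comm := fun b v h =>
          (IsInitial.isInitialObj (𝒢.pull b v h).pullback (A.S v) (hS v).some).hom_ext _ _ })
    fun _ _ => BObj.Hom.ext (funext fun v => (hS v).some.hom_ext _ _)
      (funext fun e => (hT e).some.hom_ext _ _)⟩

/-- Along a branch `b` of `e` abutting to `v`, `S_v` is non-initial iff `T_e` is (transport along
`ψ_b : b^* S_v ⥲ T_e`; `b^*` is exact). [cite: MochizukiSemiAnbd2006, Def. 2.1 p.23] -/
theorem BObj.not_isInitial_S_iff (A : 𝒢.BObj) (b : 𝒢.graph.Branch) (v : 𝒢.graph.Vertex)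
    (h : 𝒢.graph.abuts b = some v) :
    (IsInitial (A.S v) → False) ↔ (IsInitial (A.T (𝒢.graph.edgeOf b)) → False) := by
  constructor
  · exact fun hS hTe =>
      not_isInitial_obj_of_exact (𝒢.pull b v h).pullback hS (hTe.ofIso (A.ψ b v h).symm)
  · exact fun hT hSv =>
      hT ((IsInitial.isInitialObj (𝒢.pull b v h).pullback (A.S v) hSv).ofIso (A.ψ b v h))

/-- **Over a connected semi-graph, a non-initial object of `B(𝒢)` has no initial vertex
constituent** (non-initiality is constant on the barycentric subdivision).
[cite: MochizukiSemiAnbd2006, Def. 2.1 p.23] -/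
theorem BObj.not_isInitial_S_of_isConnected (h𝒢 : 𝒢.IsConnected) (A : 𝒢.BObj)
    (hA : IsInitial A → False) (v : 𝒢.graph.Vertex) : IsInitial (A.S v) → False := by
  classical
  -- the predicate "the constituent at this node is non-initial"
  let Q : 𝒢.graph.Node → Prop := fun n =>
    match n with
    | Sum.inl w => IsInitial (A.S w) → False
    | Sum.inr (Sum.inl e) => IsInitial (A.T e) → False
    | Sum.inr (Sum.inr b) => IsInitial (A.T (𝒢.graph.edgeOf b)) → False
  have hQ : ∀ ⦃m n : 𝒢.graph.Node⦄, 𝒢.graph.subdivision.Adj m n → (Q m ↔ Q n) := by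
    have key : ∀ ⦃m n : 𝒢.graph.Node⦄, 𝒢.graph.NodeRel m n → (Q m ↔ Q n) := by
      rintro _ _ (⟨b⟩ | ⟨b, w, hw⟩)
      · exact Iff.rfl
      · exact (A.not_isInitial_S_iff b w hw).symm
    intro m n hmn
    rw [SemiGraph.subdivision, SimpleGraph.fromRel_adj] at hmn
    rcases hmn.2 with hr | hr
    · exact key hr
    · exact (key hr).symm
  have hconst : ∀ m n : 𝒢.graph.Node, Q m ↔ Q n := fun m n =>
    iff_of_reachable Q hQ (h𝒢.isConnected.connected.preconnected m n)
  intro hv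
  -- then every constituent is initial, so `A` is initial
  have hall : ∀ n, ¬ Q n := fun n hn => (hconst n (Sum.inl v)).mp hn hv
  refine hA (A.nonempty_isInitial_of_components (fun w => ?_) (fun e => ?_)).some
  · by_contra hne
    exact hall (Sum.inl w) fun hi => hne ⟨hi⟩
  · by_contra hne
    exact hall (Sum.inr (Sum.inl e)) fun hi => hne ⟨hi⟩

/-- NAMED FACT (D9) `covering_vertexMap_surjective`, PROVED: the finite étale covering attached to a
connected object of `B(𝒢)`, `𝒢` connected, has a vertex over every vertex of `𝒢` (its vertices
over `v` are the connected components of `S_v`, which is non-initial).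
[cite: MochizukiSemiAnbd2006, Def. 2.2(i) p.23] -/
theorem covering_vertexMap_surjective_holds : covering_vertexMap_surjective.{v₁, u₁, u} := by
  intro 𝒢 𝒢' φ A h𝒢 hφ hA v
  obtain ⟨-, cV, -, hbijV, -⟩ := hφ
  obtain ⟨P⟩ := nonempty_π₀Obj (A.S v)
    (BObj.not_isInitial_S_of_isConnected h𝒢 A (fun hi => hA.notInitial hi) v)
  obtain ⟨v', hv'⟩ := hbijV.2 ⟨v, P⟩
  exact ⟨v', congrArg Sigma.fst hv'⟩

end SemiGraphOfAnabelioids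

end Literature.AnabelianGeometry.SemiGraphs
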